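import Summits.ValiantsHypothesis.ValiantsHypothesis.Theorems.ValuativeGCTValuativeBoundNegativeColumns

/-!
# `ValuativeGCT.ValuativeBound` (stmt-ValiantsHypothesis-12625) — negative side, 4/5: side of Stab, `g⁻¹`

* `valuativeBound_false_left_stab`: the crux with the Stab clause on the wrong side
  (`A ↦ M·A` for `A ↦ A·M`) is FALSE (`m = 2`, `U = ⊤`, `r = 2`, `δ = 1`, `λ = (2)`; the row swap
  `(0,0) ↔ (1,1)` stabilises `det_2` and, with Lemma R, empties the support).
* `valuativeBound_false_borel_no_inv` / `borelNoInv_fails_at m`: the crux with `g` for `g⁻¹` in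
  the Borel clause is FALSE at every `m ≥ 1` (scalar `2·1 ∈ B` acts by `2^m` and by `2^{-m}`).
So the crux's transport of `coordRep` — `(g·F)(v) = F(g⁻¹v)`, right action of the stabiliser — is
forced, not merely consistent.  Elementary; no new facts.
-/

noncomputable section

open MvPolynomial

namespace Summit.ValiantsHypothesis.Theorems.ValuativeBoundNegative

open Literature.NumberTheory.DiophantineGeometry Literature.Computability.AlgebraicComplexity

section LeftStab

/-- LEFT-`Stab` invariants `G(M·A) = G(A)` — NOT the crux's clause (which is `G(A·M) = G(A)`):
the substitution is `X (j,i) ↦ ∑ l, M j l • X (l,i)`. [folklore] -/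
def leftStabInvariants (m : ℕ) : Submodule ℂ (MvPolynomial (MatIdx m × MatIdx m) ℂ) :=
  ⨅ (M : Matrix (MatIdx m) (MatIdx m) ℂ) (_ : linSubst (MatIdx m) ℂ M (detFormLex ℂ m) = detFormLex ℂ m),
    LinearMap.ker ((MvPolynomial.aeval (R := ℂ) fun p : MatIdx m × MatIdx m =>
      ∑ l : MatIdx m, M p.1 l • MvPolynomial.X (l, p.2)).toLinearMap -
      LinearMap.id (R := ℂ) (M := MvPolynomial (MatIdx m × MatIdx m) ℂ))

/-- The truncation with the LEFT-`Stab` clause. [folklore] -/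
def truncationLeft (m : ℕ) (L : Set (MatIdx m × MatIdx m → ℂ)) (t n : ℕ) (χ : Weight (MatIdx m)) :
    Submodule ℂ (MvPolynomial (MatIdx m × MatIdx m) ℂ) :=
  MvPolynomial.homogeneousSubmodule (MatIdx m × MatIdx m) ℂ n ⊓
    ((MvPolynomial.vanishingIdeal ℂ L) ^ t).restrictScalars ℂ ⊓ leftStabInvariants m ⊓ borelSemiInvariants m χ

/-- The left-Stab clause as a family of substitution identities. [folklore] -/
theorem mem_leftStabInvariants_iff {m : ℕ} {G : MvPolynomial (MatIdx m × MatIdx m) ℂ} :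
    G ∈ leftStabInvariants m ↔ ∀ M : Matrix (MatIdx m) (MatIdx m) ℂ,
      linSubst (MatIdx m) ℂ M (detFormLex ℂ m) = detFormLex ℂ m →
      MvPolynomial.aeval (fun p : MatIdx m × MatIdx m => ∑ l : MatIdx m, M p.1 l • X (l, p.2)) G = G := by
  simp only [leftStabInvariants, Submodule.mem_iInf, LinearMap.mem_ker, LinearMap.sub_apply,
    LinearMap.id_apply, AlgHom.toLinearMap_apply, sub_eq_zero]

/-- The lex-first index `(0,0)` of `MatIdx 2`. [folklore] -/
def iFirst : MatIdx 2 := toLex (0, 0)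

/-- `(0,0) ≠ (1,1)`. [folklore] -/
theorem iFirst_ne_iLast : iFirst ≠ iLast 2 := by decide

/-- The transposition `(0,0) ↔ (1,1)` of the matrix positions. [folklore] -/
def swapFL : Equiv.Perm (MatIdx 2) := Equiv.swap iFirst (iLast 2)

/-- Its permutation matrix in the `linSubst` convention: `X i ↦ X (swapFL i)`. [folklore] -/
def swapMatrix : Matrix (MatIdx 2) (MatIdx 2) ℂ := fun j i => if j = swapFL i then 1 else 0

/-- `swapMatrix` acts on variables by `swapFL`. [folklore] -/
theorem linSubst_swapMatrix_X (i : MatIdx 2) :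
    linSubst (MatIdx 2) ℂ swapMatrix (X i) = X (swapFL i) := by
  classical
  rw [linSubst_X, Finset.sum_eq_single (swapFL i)]
  · simp [swapMatrix]
  · intro j _ hj
    simp [swapMatrix, hj]
  · intro h; exact absurd (Finset.mem_univ _) h

/-- `det_2 = x₀₀ x₁₁ - x₀₁ x₁₀` in the lex variables. [folklore] -/
theorem detFormLex_two : detFormLex ℂ 2 =
    X iFirst * X (iLast 2) - X (toLex (0, 1)) * X (toLex (1, 0)) := by
  rw [detFormLex, detPoly, AlgHom.map_det, Matrix.det_fin_two]
  simp only [AlgHom.mapMatrix_apply, Matrix.map_apply, Matrix.mvPolynomialX_apply, rename_X]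
  rfl

/-- **`x ↦ swap(x₀₀, x₁₁)` stabilises `det_2`.** [folklore] -/
theorem linSubst_swapMatrix_detFormLex :
    linSubst (MatIdx 2) ℂ swapMatrix (detFormLex ℂ 2) = detFormLex ℂ 2 := by
  rw [detFormLex_two]
  simp only [map_sub, map_mul, linSubst_swapMatrix_X]
  have h1 : swapFL iFirst = iLast 2 := Equiv.swap_apply_left _ _
  have h2 : swapFL (iLast 2) = iFirst := Equiv.swap_apply_right _ _
  have h3 : swapFL (toLex (0, 1)) = toLex (0, 1) := Equiv.swap_apply_of_ne_of_ne (by decide) (by decide)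
  have h4 : swapFL (toLex (1, 0)) = toLex (1, 0) := Equiv.swap_apply_of_ne_of_ne (by decide) (by decide)
  rw [h1, h2, h3, h4, mul_comm]

/-- The swap of the ROW index of `End W`. [folklore] -/
def rowSwap : (MatIdx 2 × MatIdx 2) ≃ (MatIdx 2 × MatIdx 2) :=
  Equiv.prodCongr swapFL (Equiv.refl _)

/-- Unfolding lemma for `rowSwap`. [folklore] -/
@[simp] theorem rowSwap_apply (p : MatIdx 2 × MatIdx 2) : rowSwap p = (swapFL p.1, p.2) := rfl

/-- The LEFT-`Stab` substitution at the swap matrix is `rename rowSwap`. [folklore] -/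
theorem aeval_leftFun_swapMatrix :
    (MvPolynomial.aeval fun p : MatIdx 2 × MatIdx 2 =>
      ∑ l : MatIdx 2, swapMatrix p.1 l • (X (l, p.2) : MvPolynomial (MatIdx 2 × MatIdx 2) ℂ)) =
      rename rowSwap := by
  classical
  apply MvPolynomial.algHom_ext
  intro p
  rw [aeval_X, rename_X, rowSwap_apply, Finset.sum_eq_single (swapFL p.1)]
  · simp [swapMatrix, swapFL, Equiv.swap_apply_self]
  · intro l _ hl
    have : swapMatrix p.1 l = 0 := by
      simp only [swapMatrix]
      rw [if_neg]
      intro h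
      apply hl
      rw [h, swapFL, Equiv.swap_apply_self]
    rw [this, zero_smul]
  · intro h; exact absurd (Finset.mem_univ _) h

/-- **The LEFT-Stab truncation of a one-row weight is ZERO in every positive degree** (whatever
the vanishing locus and threshold): Lemma R puts every monomial on the last row; invariance under
the row swap `(0,0) ↔ (1,1)` (which stabilises `det_2`) puts it on the first row too. [folklore] -/
theorem truncationLeft_lastWeight_eq_bot (L : Set (MatIdx 2 × MatIdx 2 → ℂ)) (t : ℕ) {n : ℕ}
    (hn : n ≠ 0) (N : ℕ) : truncationLeft 2 L t n (lastWeight 2 N) = ⊥ := by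
  classical
  rw [eq_bot_iff]
  intro G hG
  simp only [truncationLeft, Submodule.mem_inf, Submodule.restrictScalars_mem] at hG
  obtain ⟨⟨⟨hH, -⟩, hS⟩, hB⟩ := hG
  have hswap := (mem_leftStabInvariants_iff.mp hS) swapMatrix linSubst_swapMatrix_detFormLex
  rw [aeval_leftFun_swapMatrix] at hswap
  refine (Submodule.mem_bot ℂ).mpr ?_
  by_contra hG0
  obtain ⟨e, he⟩ := Finset.nonempty_iff_ne_empty.mpr (support_eq_empty.not.mpr hG0)
  -- every exponent of `e` vanishes
  have hzero : ∀ p, e p = 0 := by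
    intro p
    by_cases hp : p.1 = iLast 2
    · have he' : Finsupp.mapDomain rowSwap e ∈ G.support := by
        have : Finsupp.mapDomain rowSwap e ∈ (rename rowSwap G).support := by
          rw [support_rename_of_injective rowSwap.injective]
          exact Finset.mem_image_of_mem _ he
        rwa [hswap] at this
      have h := apply_eq_zero_of_mem_borelSemiInvariants_lastWeight hB he' (p := rowSwap p)
        (by rw [rowSwap_apply, hp]; exact (Equiv.swap_apply_right _ _).trans_ne iFirst_ne_iLast)
      rwa [Finsupp.mapDomain_apply rowSwap.injective] at h
    · exact apply_eq_zero_of_mem_borelSemiInvariants_lastWeight hB he hp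
  have hdeg : e.degree = n := by
    rw [Finsupp.degree_eq_weight_one]
    exact (mem_homogeneousSubmodule n G).mp hH (mem_support_iff.mp he)
  apply hn
  rw [← hdeg, Finsupp.degree_eq_sum]
  exact Finset.sum_eq_zero fun p _ => hzero p

/-- **THE SIDE OF THE STAB ACTION IS LOAD-BEARING (left variant is FALSE).** Witness `m = 2`,
`U = ⊤`, `r = 2`, `δ = 1`, `λ = (2)`: threshold `0` (no vanishing condition at all),
`K_2((2)*) ≥ 1`, left truncation `= 0`.  The crux's right action `A ↦ A·M` is the correct
transport: `Φ(F)(A·M) = F(linSubst A (linSubst M det)) = Φ(F)(A)` (tree `linSubst_mul`,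
`eval_orbitCoordToPoly_mul_right`). [folklore] -/
theorem valuativeBound_false_left_stab :
    ¬ (∀ (m : ℕ) [NeZero m] (U : Submodule ℂ (MatIdx m → ℂ)) (r : ℕ),
        (∀ u ∈ U, (Matrix.of fun a b : Fin m => u (toLex (a, b))).rank ≤ r) →
        ∀ (δ : ℕ) (lam : Nat.Partition (m * δ)), lam.parts.card ≤ m * m →
          orbitMultiplicity ℂ (detFormLex ℂ m) m (Weight.dualOfPartition (m * m) lam).toMatIdx ≤
            Module.finrank ℂ (truncationLeft m (rowLocus m U) (δ * (m - r)) (m * δ)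
              (Weight.dualOfPartition (m * m) lam).toMatIdx)) := by
  intro h
  have h1 := h 2 ⊤ 2 (fun u _ => Matrix.rank_le_width _) 1 (Nat.Partition.indiscrete (2 * 1))
    (card_parts_indiscrete_le 2 _)
  rw [toMatIdx_dualOfPartition_indiscrete 2 1,
    truncationLeft_lastWeight_eq_bot _ _ (by norm_num) (2 * 1), finrank_bot] at h1
  exact Nat.not_succ_le_zero _ (le_trans (one_le_orbitMultiplicity_det_lastWeight 2 1) h1)

end LeftStab

section BorelNoInverse

variable {m : ℕ}

/-- `B`-semi-invariants with `g` in place of `g⁻¹` — NOT the crux's clause. [folklore] -/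
def borelSemiInvariantsNoInv (m : ℕ) (χ : Weight (MatIdx m)) :
    Submodule ℂ (MvPolynomial (MatIdx m × MatIdx m) ℂ) :=
  ⨅ (g : Matrix.GeneralLinearGroup (MatIdx m) ℂ) (_ : IsUpperTriangular g),
    LinearMap.ker ((MvPolynomial.aeval (R := ℂ) fun p : MatIdx m × MatIdx m =>
      ∑ l : MatIdx m, ((g : Matrix.GeneralLinearGroup (MatIdx m) ℂ) :
        Matrix (MatIdx m) (MatIdx m) ℂ) p.1 l • MvPolynomial.X (l, p.2)).toLinearMap -
      weightChar χ g • LinearMap.id (R := ℂ) (M := MvPolynomial (MatIdx m × MatIdx m) ℂ))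

/-- The truncation with the `g`-for-`g⁻¹` Borel clause. [folklore] -/
def truncationNoInv (m : ℕ) (L : Set (MatIdx m × MatIdx m → ℂ)) (t n : ℕ) (χ : Weight (MatIdx m)) :
    Submodule ℂ (MvPolynomial (MatIdx m × MatIdx m) ℂ) :=
  MvPolynomial.homogeneousSubmodule (MatIdx m × MatIdx m) ℂ n ⊓
    ((MvPolynomial.vanishingIdeal ℂ L) ^ t).restrictScalars ℂ ⊓ stabInvariants m ⊓ borelSemiInvariantsNoInv m χ

/-- The `g`-for-`g⁻¹` clause as a family of substitution identities. [folklore] -/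
theorem mem_borelSemiInvariantsNoInv_iff {χ : Weight (MatIdx m)} {G : MvPolynomial (MatIdx m × MatIdx m) ℂ} :
    G ∈ borelSemiInvariantsNoInv m χ ↔ ∀ g : GL (MatIdx m) ℂ, IsUpperTriangular g →
      MvPolynomial.aeval (fun p : MatIdx m × MatIdx m =>
        ∑ l : MatIdx m, ((g : GL (MatIdx m) ℂ) : Matrix (MatIdx m) (MatIdx m) ℂ) p.1 l • X (l, p.2)) G =
      weightChar χ g • G := by
  simp only [borelSemiInvariantsNoInv, Submodule.mem_iInf, LinearMap.mem_ker, LinearMap.sub_apply,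
    LinearMap.smul_apply, LinearMap.id_apply, AlgHom.toLinearMap_apply, sub_eq_zero]

/-- The scalar clause without the inverse: `G(c·x) = c^{∑χ} G(x) = (c^s)⁻¹ G(x)`. [folklore] -/
theorem aeval_smul_X_of_mem_borelSemiInvariantsNoInv {χ : Weight (MatIdx m)}
    {G : MvPolynomial (MatIdx m × MatIdx m) ℂ} (hB : G ∈ borelSemiInvariantsNoInv m χ) {s : ℕ}
    (hs : χ.size = -(s : ℤ)) {c : ℂ} (hc : c ≠ 0) :
    MvPolynomial.aeval (fun p : MatIdx m × MatIdx m => c • (X p : MvPolynomial _ ℂ)) G = (c ^ s)⁻¹ • G := by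
  classical
  set g : GL (MatIdx m) ℂ := torusElt (fun _ : MatIdx m => c) (fun _ => hc) with hg
  have hgU : IsUpperTriangular g := (isDiagonalGL_torusElt _ _).isUpperTriangular
  have h := (mem_borelSemiInvariantsNoInv_iff.mp hB) g hgU
  have hfun : (fun p : MatIdx m × MatIdx m => ∑ l : MatIdx m,
      ((g : GL (MatIdx m) ℂ) : Matrix (MatIdx m) (MatIdx m) ℂ) p.1 l • (X (l, p.2) : MvPolynomial _ ℂ)) =
      fun p => c • X p := by
    funext p
    rw [hg, coe_torusElt, Finset.sum_eq_single p.1 (fun l _ hl => by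
      rw [Matrix.diagonal_apply_ne _ (Ne.symm hl), zero_smul]) (fun h => absurd (Finset.mem_univ _) h),
      Matrix.diagonal_apply_eq]
  have hw : weightChar χ g = (c ^ s)⁻¹ := by
    rw [hg, weightChar_torusElt, prod_zpow_eq_zpow_sum hc]
    change c ^ χ.size = (c ^ s)⁻¹
    rw [hs, zpow_neg, zpow_natCast]
  rw [hfun, hw] at h
  exact h

/-- **With `g` for `g⁻¹` the truncation is ZERO as soon as degree + |weight| > 0**: the scalar
`2·1 ∈ B` acts by `2^n` (homogeneity) and by `2^{-s}` (the clause), and `2^n ≠ 2^{-s}`. [folklore] -/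
theorem truncationNoInv_eq_bot (L : Set (MatIdx m × MatIdx m → ℂ)) (t : ℕ) {n s : ℕ}
    {χ : Weight (MatIdx m)} (hs : χ.size = -(s : ℤ)) (hns : n + s ≠ 0) :
    truncationNoInv m L t n χ = ⊥ := by
  rw [eq_bot_iff]
  intro G hG
  simp only [truncationNoInv, Submodule.mem_inf, Submodule.restrictScalars_mem] at hG
  obtain ⟨⟨⟨hH, -⟩, -⟩, hB⟩ := hG
  have h1 := aeval_smul_X_of_mem_homogeneousSubmodule hH (2 : ℂ)
  have h2 := aeval_smul_X_of_mem_borelSemiInvariantsNoInv hB hs (two_ne_zero)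
  rw [h1] at h2
  have h3 : ((2 : ℂ) ^ n - ((2 : ℂ) ^ s)⁻¹) • G = 0 := by rw [sub_smul, h2, sub_self]
  refine (Submodule.mem_bot ℂ).mpr ?_
  rcases smul_eq_zero.mp h3 with h4 | h4
  · exfalso
    have h5 : (2 : ℂ) ^ n * 2 ^ s = 1 := by
      rw [sub_eq_zero.mp h4, inv_mul_cancel₀ (pow_ne_zero _ two_ne_zero)]
    rw [← pow_add] at h5
    exact two_pow_ne_two_pow hns (h5.trans (pow_zero _).symm)
  · exact h4

/-- **THE INVERSE IN THE BOREL CLAUSE IS LOAD-BEARING (`g`-for-`g⁻¹` variant is FALSE)**, at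
every `m ≥ 1`: witness `U = ⊤`, `r = m`, `δ = 1`, `λ = (m)` (threshold `0`): `K_m((m)*) ≥ 1` but
the variant truncation is `0` (`n = s = m`).  The crux's `g⁻¹` is the correct transport of
`coordRep` (`(g·F)(v) = F(g⁻¹v)`, tree `aeval_formCoeff_coordSubst`): polynomial functions carry
the DUAL (nonpositive) weights, and `G(g⁻¹A)` with `weightChar χ g`, `χ ≤ 0`, is consistent with
polynomiality while `G(gA)` is not. [folklore] -/
theorem borelNoInv_fails_at (m : ℕ) [NeZero m] :
    ¬ (∀ (U : Submodule ℂ (MatIdx m → ℂ)) (r : ℕ),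
      (∀ u ∈ U, (Matrix.of fun a b : Fin m => u (toLex (a, b))).rank ≤ r) →
      ∀ (δ : ℕ) (lam : Nat.Partition (m * δ)), lam.parts.card ≤ m * m →
        orbitMultiplicity ℂ (detFormLex ℂ m) m (Weight.dualOfPartition (m * m) lam).toMatIdx ≤
          Module.finrank ℂ (truncationNoInv m (rowLocus m U) (δ * (m - r)) (m * δ)
            (Weight.dualOfPartition (m * m) lam).toMatIdx)) := by
  intro h
  have h1 := h ⊤ m (fun u _ => Matrix.rank_le_width _) 1 (Nat.Partition.indiscrete (m * 1))
    (card_parts_indiscrete_le m _)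
  have hsize : (lastWeight m (m * 1)).size = -((m * 1 : ℕ) : ℤ) := by
    classical
    simp [Weight.size, lastWeight, Finset.sum_ite_eq']
  rw [toMatIdx_dualOfPartition_indiscrete m 1,
    truncationNoInv_eq_bot _ _ hsize (by simpa using NeZero.ne m), finrank_bot] at h1
  exact Nat.not_succ_le_zero _ (le_trans (one_le_orbitMultiplicity_det_lastWeight m 1) h1)

/-- **The crux with `g` for `g⁻¹` in the Borel clause is FALSE.** [folklore] -/
theorem valuativeBound_false_borel_no_inv :
    ¬ (∀ (m : ℕ) [NeZero m] (U : Submodule ℂ (MatIdx m → ℂ)) (r : ℕ),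
        (∀ u ∈ U, (Matrix.of fun a b : Fin m => u (toLex (a, b))).rank ≤ r) →
        ∀ (δ : ℕ) (lam : Nat.Partition (m * δ)), lam.parts.card ≤ m * m →
          orbitMultiplicity ℂ (detFormLex ℂ m) m (Weight.dualOfPartition (m * m) lam).toMatIdx ≤
            Module.finrank ℂ (truncationNoInv m (rowLocus m U) (δ * (m - r)) (m * δ)
              (Weight.dualOfPartition (m * m) lam).toMatIdx)) :=
  fun h => borelNoInv_fails_at 1 (h 1)

end BorelNoInverse

end Summit.ValiantsHypothesis.Theorems.ValuativeBoundNegative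

end
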